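import Summits.CriticalPhenomena.PercolationContinuityZ3.Theorems.PercNearOneGluingNoHeavyLowerTailFrontierDecRowsPinnedEdgeStrongInduction
import Summits.CriticalPhenomena.PercolationContinuityZ3.Theorems.PercNearOneGluingNoHeavyLowerTailFrontierDecRowsPinnedEdgeKeyB0All
import HarnessLib

/-!
# The relaxed KEY form `keyB0 = K + B₀ = 3B₁ − B₀` with the STRONG induction hypothesis

Support file (prover seat `prim-facecert`, gen 6; `--supports stmt-CriticalPhenomena-4575`).  No named facts, no sorries, no `native_decide`; one
bookkeeping definition `KeyB0HypAtStrong` = prim-bnk-1 gen 11's `KeyHypAtStrong` (`…PinnedEdgeStrongInduction`) with the conclusion `0 ≤ key`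
replaced by the weaker `0 ≤ keyB0 = key + E₃(μ⁰)` of `…PinnedEdgeKeyB0All`.

WHY.  A polynomial certificate of `keyB0 ≥ 0` at the edge `(x i₀, u)` may use, besides the theorem rows, the row `E₃ ≥ 0` under EVERY weight function
with fewer fractional pairs (`StrongIH`): in the 52 five-point cells these are the row at all injective markings of `{a,b,c,y,u}` under `μ⁰ = μ_{w[e↦0]}`
AND under every SURE GLUING of the five points (pairs set to weight `1`; the facecert LP families `IHX` + `IHG`).  From `keyB0 ≥ 0` both polarised
Bernstein coefficients follow (`polar₁_nonneg_of_keyB0`, `polar₁_swap_nonneg_of_keyB0`), hence bnk-1's strong pinned package and the row for all `n`.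
* `KeyB0HypAtStrong i₀ Φ₁ Φ₂ Φ₃ m`, `KeyHypAtStrong.toKeyB0`, `pinnedFamilyHypStrong_of_keyB0HypAtStrong`;
* `sahiE3_sepPat_nonneg_of_keyB0HypAtStrong` (first separation pinned at `i₀`);
* `frontier_36_all_of_keyB0AtStrong_hub` — PATH on every finite weighted graph from `keyB0 ≥ 0` at the hub with the strong induction hypothesis.
-/

noncomputable section

namespace Summit.CriticalPhenomena.PercolationContinuityZ3.Theorems

namespace TerminalEdgeInduction

open MeasureTheory Literature.Probability.Percolation Literature.Probability.LatticeModels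
open EdgeInduction CovTransferCert E3GroupSepCert
open scoped Classical

variable {n k : ℕ}

/-- **`keyB0` hypothesis at the terminal slot `i₀` with the STRONG induction hypothesis, at dimension `m`**: for every `w`, injective `x`, unmarked `u`
with `e = s(x i₀, u)` fractional: `StrongIH` at `w` ⟹ `0 ≤ keyB0 μ_{w[e↦0]} μ_{w[e↦1]} (pev Φ₁ x) (pev Φ₂ x) (pev Φ₃ x)`. [this work] -/
def KeyB0HypAtStrong (i₀ : Fin k) (Φ₁ Φ₂ Φ₃ : (Fin k → Fin k → Bool) → Bool) (m : ℕ) : Prop :=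
  ∀ (w : Sym2 (Fin m) → unitInterval) (x : Fin k → Fin m), Function.Injective x → ∀ (u : Fin m), (∀ j, x j ≠ u) →
    s(x i₀, u) ∈ frac w → StrongIH (ι := Unit) (fun _ => Φ₁) (fun _ => Φ₂) (fun _ => Φ₃) w →
    0 ≤ keyB0 (prodBernoulli (Function.update w s(x i₀, u) 0)) (prodBernoulli (Function.update w s(x i₀, u) 1))
        (pev Φ₁ x) (pev Φ₂ x) (pev Φ₃ x)

/-- `KeyHypAtStrong` implies `KeyB0HypAtStrong` (`B₀ ≥ 0` is an instance of the strong hypothesis). [this work] -/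
theorem KeyHypAtStrong.toKeyB0 {i₀ : Fin k} {Φ₁ Φ₂ Φ₃ : (Fin k → Fin k → Bool) → Bool} {m : ℕ}
    (h : KeyHypAtStrong i₀ Φ₁ Φ₂ Φ₃ m) : KeyB0HypAtStrong i₀ Φ₁ Φ₂ Φ₃ m := by
  intro w x hx u hu he IH
  obtain ⟨i0, _⟩ := IH.update he () x hx
  exact keyB0_nonneg_of_key i0 (h w x hx u hu he IH)

/-- **`keyB0 ≥ 0` (strong IH) ⇒ the strong pinned package**, for a decreasing pattern row: `3B₁ = keyB0 + B₀`, `3B₂ = keyB0 + B₃ + π_A π_B π_C`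
with `B₀, B₃ ≥ 0` instances of the strong hypothesis (`StrongIH.update`) and `π_A π_B π_C ≥ 0` (`pivotal_prod_nonneg`). [this work] -/
theorem pinnedFamilyHypStrong_of_keyB0HypAtStrong {i₀ : Fin k} {Φ₁ Φ₂ Φ₃ : (Fin k → Fin k → Bool) → Bool}
    (hΦ₁ : ∀ (m : ℕ) (x : Fin k → Fin m), IsLowerSet (pev Φ₁ x)) (hΦ₂ : ∀ (m : ℕ) (x : Fin k → Fin m), IsLowerSet (pev Φ₂ x))
    (hΦ₃ : ∀ (m : ℕ) (x : Fin k → Fin m), IsLowerSet (pev Φ₃ x)) {m : ℕ} (h : KeyB0HypAtStrong i₀ Φ₁ Φ₂ Φ₃ m) :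
    PinnedFamilyHypStrong (ι := Unit) (fun _ => Φ₁) (fun _ => Φ₂) (fun _ => Φ₃) (fun _ => i₀) m := by
  intro w r x hx u hu he IH
  have hK := h w x hx u hu he IH
  obtain ⟨i0, i1⟩ := IH.update he () x hx
  exact ⟨polar₁_nonneg_of_keyB0 i0 hK,
    polar₁_swap_nonneg_of_keyB0 i1 hK (pivotal_prod_nonneg w s(x i₀, u) (hΦ₁ m x) (hΦ₂ m x) (hΦ₃ m x))⟩

/-- **Three group separations as patterns, the FIRST pinned at `i₀`, from `keyB0 ≥ 0` with the strong induction hypothesis.** [this work] -/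
theorem sahiE3_sepPat_nonneg_of_keyB0HypAtStrong (i₀ : Fin k) (I₁ J₁ I₂ J₂ I₃ J₃ : List (Fin k)) (hpin : I₁ = [i₀] ∨ J₁ = [i₀])
    (h : ∀ m : ℕ, KeyB0HypAtStrong i₀ (sepPat I₁ J₁) (sepPat I₂ J₂) (sepPat I₃ J₃) m)
    (w : Sym2 (Fin n) → unitInterval) (x : Fin k → Fin n) (hx : Function.Injective x) :
    0 ≤ sahiE3 (prodBernoulli w) (connEvent (sep (I₁.map x) (J₁.map x))) (connEvent (sep (I₂.map x) (J₂.map x)))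
      (connEvent (sep (I₃.map x) (J₃.map x))) := by
  have hΦ : PinnedPat i₀ (sepPat I₁ J₁) := by
    rcases hpin with rfl | rfl
    · exact pinnedPat_sepPat_left i₀ J₁
    · exact pinnedPat_sepPat_right i₀ I₁
  have hlow : ∀ (I J : List (Fin k)) (m : ℕ) (x : Fin k → Fin m), IsLowerSet (pev (sepPat I J) x) := by
    intro I J m x; rw [pev_sepPat]; exact isLowerSet_connEvent_sep _ _
  rw [← pev_sepPat, ← pev_sepPat, ← pev_sepPat]
  refine sahiE3_pev_nonneg_of_pinnedFamilyHypStrong (ι := Unit) (fun _ => sepPat I₁ J₁) (fun _ => sepPat I₂ J₂) (fun _ => sepPat I₃ J₃) (fun _ => i₀)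
    (fun _ => hΦ) (fun _ m w' x' => ?_) (fun m => pinnedFamilyHypStrong_of_keyB0HypAtStrong (hlow I₁ J₁) (hlow I₂ J₂) (hlow I₃ J₃) (h m)) w () x hx
  rw [pev_sepPat, pev_sepPat]; exact real_mul_le_inter_sep w' _ _ _ _

/-- **PATH `(D[a|b], D[a|c], D[b|y])` on every finite weighted graph from `keyB0 = 3B₁ − B₀ ≥ 0` at the HUB `a`, certified with the STRONG induction
hypothesis** (all markings; the degenerate markings are three-point rows / trivial, exactly as in `frontier_36_all_of_keyAtStrong_hub`). [this work] -/
theorem frontier_36_all_of_keyB0AtStrong_hub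
    (h : ∀ m : ℕ, KeyB0HypAtStrong (k := 4) 0 (sepPat [0] [1]) (sepPat [0] [2]) (sepPat [1] [3]) m)
    (w : Sym2 (Fin n) → unitInterval) (a b c y : Fin n) :
    0 ≤ sahiE3 (prodBernoulli w) (connEvent (FrontierDecRows.row 36 n (a, b, c, y)).1)
      (connEvent (FrontierDecRows.row 36 n (a, b, c, y)).2.1) (connEvent (FrontierDecRows.row 36 n (a, b, c, y)).2.2) := by
  have hr : FrontierDecRows.row 36 n (a, b, c, y) = (sep [a] [b], sep [a] [c], sep [b] [y]) := rfl
  rw [hr]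
  dsimp only
  by_cases hab : a = b
  · subst hab; exact le_of_eq (sahiE3_sep_eq_zero_left (v := a) (by simp) (by simp) _ _).symm
  by_cases hac : a = c
  · subst hac; exact le_of_eq (sahiE3_sep_eq_zero_mid (v := a) (by simp) (by simp) _ _).symm
  by_cases hby : b = y
  · subst hby; exact le_of_eq (sahiE3_sep_eq_zero_right (v := b) (by simp) (by simp) _ _).symm
  by_cases hay : a = y
  · subst hay
    rw [connEvent_sep_comm [b] [a]]
    exact sahiE3_nonneg_of_repeat₁₃ w (isLowerSet_connEvent_sep _ _) (isLowerSet_connEvent_sep _ _)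
  by_cases hbc : b = c
  · subst hbc
    exact sahiE3_nonneg_of_repeat₁₂ w (isLowerSet_connEvent_sep _ _) (isLowerSet_connEvent_sep _ _)
  by_cases hcy : c = y
  · subst hcy
    rw [connEvent_sep_one_one, connEvent_sep_one_one, connEvent_sep_one_one]
    exact ThreePointLB.sahiE3_pairSep_nonneg w a b c
  exact sahiE3_sepPat_nonneg_of_keyB0HypAtStrong (k := 4) 0 [0] [1] [0] [2] [1] [3] (Or.inl rfl) h w ![a, b, c, y]
    (injective_vec4 hab hac hay hbc hby hcy)

/-! ### Admissibility of the glued induction rows (the facecert LP family `IHG`) under the strong hypothesis -/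

/-- Setting any pair to weight `0` or `1` never increases the number of fractional pairs. [folklore] -/
theorem card_frac_update_le (w : Sym2 (Fin n) → unitInterval) (f : Sym2 (Fin n)) (v : unitInterval) (hv : v = 0 ∨ v = 1) :
    (frac (Function.update w f v)).card ≤ (frac w).card := by
  refine Finset.card_le_card fun g hg => ?_
  simp only [frac, Finset.mem_filter, Finset.mem_univ, true_and] at hg ⊢
  by_cases hgf : g = f
  · subst hgf
    rw [Function.update_self] at hg
    rcases hv with rfl | rfl
    · simp at hg
    · simp at hg
  · rw [Function.update_of_ne hgf] at hg
    exact hg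

/-- **A sure gluing of `w[e↦0]` or `w[e↦1]` has fewer fractional pairs than `w`** (`e` fractional): `|frac (w[e↦v][f↦1])| < |frac w|` for `v ∈ {0,1}`. [this work] -/
theorem card_frac_update_update_one_lt (w : Sym2 (Fin n) → unitInterval) {e : Sym2 (Fin n)} (he : e ∈ frac w) (v : unitInterval)
    (hv : v = 0 ∨ v = 1) (f : Sym2 (Fin n)) :
    (frac (Function.update (Function.update w e v) f 1)).card < (frac w).card :=
  lt_of_le_of_lt (card_frac_update_le _ f 1 (Or.inr rfl)) (card_frac_update_lt w he v hv)

/-- **The glued rows are instances of the strong hypothesis.**  `StrongIH` at `w` gives `0 ≤ E₃(row r' at x')` under `w[e↦v][f↦1]` for `v ∈ {0,1}`, EVERY pair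
`f` (a sure gluing of `G∖e` resp. `G/e`) and every injective marking `x'` — these are the `IHG` rows of the facecert certificate LP (iterate for several glued pairs). [this work] -/
theorem StrongIH.update_glue {ι : Type*} {Φ₁ Φ₂ Φ₃ : ι → (Fin k → Fin k → Bool) → Bool} {m : ℕ} {w : Sym2 (Fin m) → unitInterval}
    (h : StrongIH Φ₁ Φ₂ Φ₃ w) {e : Sym2 (Fin m)} (he : e ∈ frac w) (v : unitInterval) (hv : v = 0 ∨ v = 1) (f : Sym2 (Fin m))
    (r' : ι) (x' : Fin k → Fin m) (hx' : Function.Injective x') :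
    0 ≤ sahiE3 (prodBernoulli (Function.update (Function.update w e v) f 1)) (pev (Φ₁ r') x') (pev (Φ₂ r') x') (pev (Φ₃ r') x') :=
  h m _ (card_frac_update_update_one_lt w he v hv f) r' x' hx'

/-- Two glued pairs (and so on by iteration: every further sure gluing keeps the count below `|frac w|`). [this work] -/
theorem StrongIH.update_glue₂ {ι : Type*} {Φ₁ Φ₂ Φ₃ : ι → (Fin k → Fin k → Bool) → Bool} {m : ℕ} {w : Sym2 (Fin m) → unitInterval}
    (h : StrongIH Φ₁ Φ₂ Φ₃ w) {e : Sym2 (Fin m)} (he : e ∈ frac w) (v : unitInterval) (hv : v = 0 ∨ v = 1) (f g : Sym2 (Fin m))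
    (r' : ι) (x' : Fin k → Fin m) (hx' : Function.Injective x') :
    0 ≤ sahiE3 (prodBernoulli (Function.update (Function.update (Function.update w e v) f 1) g 1))
      (pev (Φ₁ r') x') (pev (Φ₂ r') x') (pev (Φ₃ r') x') :=
  h m _ (lt_of_le_of_lt (card_frac_update_le _ g 1 (Or.inr rfl)) (card_frac_update_update_one_lt w he v hv f)) r' x' hx'

end TerminalEdgeInduction

end Summit.CriticalPhenomena.PercolationContinuityZ3.Theorems
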